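import Literature.NumberTheory.EllipticCurves.GaloisStableDivisibleSubgroupNonabelianProofs
import Literature.NumberTheory.EllipticCurves.PrimaryGroupStableImage
import HarnessLib

/-!
# `E(ℚ^{ab})[p^∞]` is finite (`p` odd): the `p`-power torsion of an elliptic curve over `ℚ` rational
# over an ABELIAN extension of `ℚ` is finite (Ribet 1981; Imai 1975 for `ℚ(μ_{p^∞})`)

`Proofs` file (theorems only; no definition, no named fact) in topic `NumberTheory/EllipticCurves`,
sequel of `GaloisStableDivisibleSubgroupNonabelianProofs` (for `p` odd, `Γ_ℚ` does not act through an
abelian quotient on a non-zero `Γ_ℚ`-stable `p`-divisible subgroup of `E[p^∞]`) and of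
`IwasawaTowerTorsionFiniteProofs` (the `ℤ_p`-extension case, any `p`). For an elliptic curve `E/ℚ`, an
ODD prime `p` and a subgroup `H ≤ Γ_ℚ` containing all commutators (`Γ_ℚ/H` abelian — e.g.
`H = Gal(ℚ̄/ℚ^{ab})`, `Gal(ℚ̄/ℚ(μ_{p^∞}))`, `Gal(ℚ̄/ℚ(μ_∞))`, the kernel of any character):

* `WeierstrassCurve.finite_fixedPoints_geomPrimaryTorsion_of_commutator_mem` — **`E[p^∞]^H` is
  finite**; in particular `E(ℚ^{ab})[p^∞]`, `E(ℚ(μ_{p^∞}))[p^∞]` (the tower of Kato's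
  `𝐇^q = lim← H^q(ℤ[ζ_{p^n}, 1/p], ·)`) and `E(ℚ(μ_∞))[p^∞]` are finite (Ribet, in Katz–Lang 1981,
  Thm. 1: `A(K(μ_∞))_{tors}` is finite; Imai 1975 for `K(μ_{p^∞})`; here `K = ℚ`, `p` odd, `p`-part);
* `WeierstrassCurve.finite_fixedPoints_geomPrimaryTorsion_ker` — the same for `H = ker f`, `f` a
  homomorphism of `Γ_ℚ` to a commutative group.

## The proof

If `B = E[p^∞]^H` is infinite, its stable image `p^{j₀} B` (`PrimaryGroup.exists_powRange_succ_eq`) is an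
infinite `p`-divisible subgroup, `Γ_ℚ`-stable because `H ⊇ [Γ_ℚ, Γ_ℚ]` is normal, on which `Γ_ℚ` acts
through the abelian group `Γ_ℚ/H` — contradicting `not_forall_smul_comm_of_stable_divisible`.
NEW FORMAL PROOF (global: Shafarevich + `End_ℚ(E) = ℤ` + Weil pairing; Ribet argues with Frobenius
eigenvalues, Imai with Hodge–Tate weights).

## References

* K. A. Ribet, *Torsion points of abelian varieties in cyclotomic extensions* (appendix to N. M. Katz,
  S. Lang, *Finiteness theorems in geometric classfield theory*), Enseign. Math. 27 (1981) 285–319,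
  Thm. 1; H. Imai, *A remark on the rational points of abelian varieties with values in cyclotomic
  `ℤ_p`-extensions*, Proc. Japan Acad. 51 (1975) 12–16.
* [GreenbergLNM1716] R. Greenberg, *Iwasawa theory for elliptic curves*, LNM 1716 (1999), §1 p. 62
  ("See also [Im] or [Ri]").
* [Kato2004Asterisque] K. Kato, Astérisque 295 (2004), §13.8 (p. 228) (`H⁰(ℚ(ζ_{p^∞}), T/p)`, the
  tower `ℚ(ζ_{p^n})`).
-/

noncomputable section

open scoped Classical AddSubgroup

universe u

namespace WeierstrassCurve

open Literature.NumberTheory.EllipticCurves Literature.NumberTheory.GaloisRepresentations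

variable (W : WeierstrassCurve ℚ) [W.IsElliptic] {p : ℕ} [Fact p.Prime]

/-- **`E[p^∞]^H` is finite for `Γ_ℚ/H` abelian (`p` odd)** — `E(ℚ^{ab})[p^∞]` is finite (Ribet, in
Katz–Lang 1981, Thm. 1, `p`-part over `ℚ`; Imai 1975 for `ℚ(μ_{p^∞})`; Greenberg LNM 1716 §1 p. 62).
For an elliptic curve `E/ℚ`, an odd prime `p` and a subgroup `H ≤ Γ_ℚ` containing every commutator
`σ τ σ⁻¹ τ⁻¹`, the fixed group `B = E[p^∞]^H` is finite: otherwise its stable image `p^{j₀} B` is an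
infinite `p`-divisible `Γ_ℚ`-stable subgroup of `E[p^∞]` on which `Γ_ℚ` acts through the abelian group
`Γ_ℚ/H`, against `not_forall_smul_comm_of_stable_divisible`. NEW FORMAL PROOF.
[cite: GreenbergLNM1716, §1 p. 62] [cite: Kato2004Asterisque, §13.8 (p. 228)] -/
theorem finite_fixedPoints_geomPrimaryTorsion_of_commutator_mem (hp2 : p ≠ 2)
    (H : Subgroup (Field.absoluteGaloisGroup ℚ))
    (hH : ∀ σ τ : Field.absoluteGaloisGroup ℚ, σ * τ * σ⁻¹ * τ⁻¹ ∈ H) :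
    Finite (FixedPoints.addSubgroup H (geomPrimaryTorsion W p)) := by
  have hp : p.Prime := Fact.out
  by_contra hinf
  set M : AddSubgroup W.geomPoints := geomPrimaryTorsion W p with hM
  set B : AddSubgroup M := FixedPoints.addSubgroup H M with hB
  -- `H` is normal-like: `σ⁻¹ τ σ ∈ H` for `τ ∈ H`; hence `B` is `Γ_ℚ`-stable
  have hconj : ∀ (σ τ : Field.absoluteGaloisGroup ℚ), τ ∈ H → σ⁻¹ * τ * σ ∈ H := fun σ τ hτ ↦ by
    have h := H.mul_mem (hH σ⁻¹ τ) hτ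
    rwa [inv_inv, inv_mul_cancel_right] at h
  have hBstab : ∀ (σ : Field.absoluteGaloisGroup ℚ) {m : M}, m ∈ B → σ • m ∈ B := by
    intro σ m hm
    rw [hB, FixedPoints.mem_addSubgroup] at hm ⊢
    rintro ⟨τ, hτ⟩
    have h := hm ⟨σ⁻¹ * τ * σ, hconj σ τ hτ⟩
    rw [Subgroup.mk_smul] at h ⊢
    calc τ • σ • m = σ • ((σ⁻¹ * τ * σ) • m) := by rw [mul_smul, mul_smul, smul_inv_smul]
      _ = σ • m := by rw [h]
  -- `Γ_ℚ` acts on `B` through the abelian quotient: `σ τ m = τ σ m`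
  have hBcomm : ∀ (σ τ : Field.absoluteGaloisGroup ℚ) {m : M}, m ∈ B → σ • τ • m = τ • σ • m := by
    intro σ τ m hm
    rw [hB, FixedPoints.mem_addSubgroup] at hm
    have h := hm ⟨σ⁻¹ * τ⁻¹ * σ⁻¹⁻¹ * τ⁻¹⁻¹, hH σ⁻¹ τ⁻¹⟩
    rw [Subgroup.mk_smul, inv_inv, inv_inv] at h
    calc σ • τ • m = (τ * σ) • ((σ⁻¹ * τ⁻¹ * σ * τ) • m) := by
          rw [← mul_smul, ← mul_smul]; congr 1; group
      _ = τ • σ • m := by rw [h, mul_smul]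
  -- `B` is `p`-primary with finite `p`-torsion
  have hprimB : ∀ b : B, ∃ k : ℕ, p ^ k • b = 0 := fun b ↦ by
    obtain ⟨k, hk⟩ := (b : M).2
    refine ⟨k, Subtype.ext (Subtype.ext ?_)⟩
    simp only [AddSubmonoidClass.coe_nsmul, ZeroMemClass.coe_zero]
    exact hk
  haveI : Finite (geomTorsion W (p : ℤ)) := finite_geomTorsion_natCast W hp.ne_zero
  haveI : Finite ((B)[(p : ℕ)]) := by
    refine Finite.of_injective (fun x : (B)[(p : ℕ)] ↦
      (⟨(((x : B) : M) : W.geomPoints), ?_⟩ : geomTorsion W (p : ℤ))) ?_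
    · refine AddSubgroup.torsionBy.nsmul_iff.mpr ?_
      have h := congrArg (fun b : B ↦ ((b : M) : W.geomPoints))
        (AddSubgroup.torsionBy.nsmul_iff.mp x.2)
      simpa only [AddSubmonoidClass.coe_nsmul, ZeroMemClass.coe_zero] using h
    · intro x y hxy
      have h := congrArg Subtype.val hxy
      dsimp only at h
      exact Subtype.ext (Subtype.ext (Subtype.ext h))
  -- the stable image `D₀ = p^{j₀} B = p^{j₀+1} B`: infinite and `p`-divisible
  obtain ⟨j₀, hj₀⟩ := PrimaryGroup.exists_powRange_succ_eq p hprimB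
  obtain ⟨t, ht⟩ := PrimaryGroup.exists_card_quotient_powRange_le p hprimB
  set D₀ : AddSubgroup B := (nsmulAddMonoidHom (p ^ j₀) : B →+ B).range with hD₀
  have hD₀inf : ¬ Finite D₀ := by
    intro hfin
    apply hinf
    haveI := (ht j₀).1
    refine Nat.finite_of_card_ne_zero ?_
    rw [← AddSubgroup.card_mul_index D₀, AddSubgroup.index_eq_card]
    exact mul_ne_zero Nat.card_pos.ne' Nat.card_pos.ne'
  have hdiv₀ : ∀ x ∈ D₀, ∃ y ∈ D₀, p • y = x := by
    rintro x hx
    have hx' : x ∈ (nsmulAddMonoidHom (p ^ (j₀ + 1)) : B →+ B).range := by rw [hj₀]; exact hx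
    obtain ⟨c, rfl⟩ := hx'
    refine ⟨p ^ j₀ • c, ⟨c, rfl⟩, ?_⟩
    change p • p ^ j₀ • c = p ^ (j₀ + 1) • c
    rw [pow_succ', mul_smul]
  -- transport to `E(ℚ̄)`
  set e : B →+ W.geomPoints := M.subtype.comp B.subtype with he_def
  have he : ∀ b : B, e b = ((b : M) : W.geomPoints) := fun _ ↦ rfl
  have he_inj : Function.Injective e := fun a b h ↦ Subtype.ext (Subtype.ext h)
  set D : AddSubgroup W.geomPoints := D₀.map e with hD
  have hprim : ∀ P ∈ D, ∃ k : ℕ, p ^ k • P = 0 := by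
    rintro _ ⟨b, -, rfl⟩
    obtain ⟨k, hk⟩ := hprimB b
    exact ⟨k, by rw [← map_nsmul, hk, map_zero]⟩
  have hdiv : ∀ P ∈ D, ∃ Q ∈ D, p • Q = P := by
    rintro _ ⟨b, hb, rfl⟩
    obtain ⟨c, hc, hcb⟩ := hdiv₀ b hb
    exact ⟨e c, ⟨c, hc, rfl⟩, by rw [← map_nsmul, hcb]⟩
  have hstab : ∀ (σ : Field.absoluteGaloisGroup ℚ) (P : W.geomPoints), P ∈ D → σ • P ∈ D := by
    rintro σ _ ⟨b, ⟨c, rfl⟩, rfl⟩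
    set c' : B := ⟨σ • (c : M), hBstab σ c.2⟩ with hc'
    refine ⟨p ^ j₀ • c', ⟨c', rfl⟩, ?_⟩
    rw [map_nsmul, nsmulAddMonoidHom_apply, map_nsmul, smul_comm σ (p ^ j₀) (e c)]
    rfl
  have hne : D ≠ ⊥ := by
    intro hDbot
    apply hD₀inf
    haveI : Subsingleton D₀ := by
      refine ⟨fun x y ↦ Subtype.ext (he_inj ?_)⟩
      have hx : e (x : B) ∈ D := ⟨x, x.2, rfl⟩
      have hy : e (y : B) ∈ D := ⟨y, y.2, rfl⟩
      rw [hDbot, AddSubgroup.mem_bot] at hx hy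
      rw [hx, hy]
    infer_instance
  -- `Γ_ℚ` commutes on `D ⊆ B`
  have hcomm : ∀ (σ τ : Field.absoluteGaloisGroup ℚ) (P : W.geomPoints), P ∈ D →
      σ • τ • P = τ • σ • P := by
    rintro σ τ _ ⟨b, -, rfl⟩
    have h := hBcomm σ τ b.2
    have h' : ((σ • τ • (b : M) : M) : W.geomPoints) = ((τ • σ • (b : M) : M) : W.geomPoints) :=
      congrArg Subtype.val h
    rw [primaryComponent.coe_smul, primaryComponent.coe_smul, primaryComponent.coe_smul,
      primaryComponent.coe_smul] at h'
    rw [he]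
    exact h'
  exact W.not_forall_smul_comm_of_stable_divisible hp2 hprim hdiv hstab hne hcomm

/-- **`E[p^∞]^{ker f}` is finite for every homomorphism `f` of `Γ_ℚ` to a commutative group** (`p`
odd): e.g. `f = χ_p` the cyclotomic character (`E(ℚ(μ_{p^∞}))[p^∞]` finite — Imai 1975; the tower of
Kato's `𝐇^q`, Astérisque 295 §13.8), `f = κ` a `ℤ_p`-extension (sibling
`finite_fixedPoints_kerSubgroup_geomPrimaryTorsion_rat`, there for all `p`), `f` the projection to
`Gal(ℚ^{ab}/ℚ)` (Ribet). [cite: GreenbergLNM1716, §1 p. 62] [cite: Kato2004Asterisque, §13.8 (p. 228)] -/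
theorem finite_fixedPoints_geomPrimaryTorsion_ker (hp2 : p ≠ 2) {C : Type*} [CommGroup C]
    (f : Field.absoluteGaloisGroup ℚ →* C) :
    Finite (FixedPoints.addSubgroup f.ker (geomPrimaryTorsion W p)) :=
  W.finite_fixedPoints_geomPrimaryTorsion_of_commutator_mem hp2 f.ker fun σ τ ↦ by
    rw [MonoidHom.mem_ker, map_mul, map_mul, map_mul, map_inv, map_inv, mul_comm (f σ) (f τ),
      mul_inv_cancel_right, mul_inv_cancel]

end WeierstrassCurve

end
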